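import Literature.AlgebraicGeometry.Resolution.HilbertSamuelPermissible
import Literature.AlgebraicGeometry.Resolution.NagataCriterion
import Literature.RingTheory.HilbertSamuel.RegularCriterion
import HarnessLib

/-!
# Normal flatness along a regular centre whose generic point is regular forces regularity
# (Cossart–Jannsen–Saito 2020, Thm. 3.3 with Lemma 2.23)

Topic: `Literature/AlgebraicGeometry/Resolution`. For a Noetherian local ring `(A, 𝔪)` and a prime
`𝔭` with `A/𝔭` regular of dimension `c` («the centre `D = V(𝔭)` is regular at `x`»), if `A` is normally
flat along `𝔭` (CJS Def. 3.1 (1): every `𝔭ᵗ/𝔭ᵗ⁺¹` is flat over `A/𝔭`) and the localization `A_𝔭` is a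
REGULAR local ring («`X` is regular at the generic point of `D`»), then `A` itself is regular. Proof:
Bennett's criterion `H^{(0)}_A = H^{(c)}_{A_𝔭}` (CJS Thm. 3.3 (1) ⇒ (2), tree
`hilbertFun_eq_hilbertSamuelFun_of_isNormallyFlat`) read in degree `1` gives `emb dim A = c + emb dim A_𝔭
= c + dim A_𝔭 = dim A/𝔭 + ht 𝔭 ≤ dim A`, so `emb dim A ≤ dim A` (Lemma 2.23 / Krull). This is the local
statement behind «a centre `D ⊂ X` which is permissible (Def. 3.1) and meets `X_reg` lies in `X_reg`»
(equimultiplicity along permissible centres, HIO, Introduction), used on the E-side of the res-hironaka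
chain W5.2 (regular hosts along weight-one centres). PROVED, no definitions, no named facts:

* `isRegularLocalRing_of_isNormallyFlat_of_isRegularLocalRing_localization` — the statement above, for
  any localization `A_𝔭` (`IsLocalization.AtPrime`);
* `Ideal.IsPermissible.isRegularLocalRing_of_isRegularLocalRing_localization` — the same from
  `𝔭.IsPermissible` (CJS Def. 3.1 (2)).

## Sources

* V. Cossart, U. Jannsen, S. Saito, *Desingularization: Invariants and Strategy*, LNM 2270 (2020),
  Def. 3.1, Thm. 3.3, Lemma 2.23. [CossartJannsenSaito2020]
* M. Herrmann, S. Ikeda, U. Orbanz, *Equimultiplicity and Blowing up*, Springer 1988, Introduction and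
  Cor. (21.12). [HerrmannIkedaOrbanz1988]
-/

noncomputable section

open IsLocalRing Literature.RingTheory.HilbertSamuel

namespace Literature.AlgebraicGeometry.Resolution

universe u v

variable {A : Type u} [CommRing A] [IsNoetherianRing A] [IsLocalRing A]
  (𝔭 : Ideal A) [𝔭.IsPrime]
  (Ap : Type v) [CommRing Ap] [Algebra A Ap] [IsLocalization.AtPrime Ap 𝔭]

/-- **Normal flatness along a regular centre with regular generic point forces regularity** (CJS
Thm. 3.3 (1) ⇒ (2) in degree one with Lemma 2.23): if `A/𝔭` is regular, `A` is normally flat along `𝔭`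
and `A_𝔭` is a regular local ring, then `A` is a regular local ring (`emb dim A = dim A/𝔭 + emb dim A_𝔭
= dim A/𝔭 + ht 𝔭 ≤ dim A`). [cite: CossartJannsenSaito2020, Thm. 3.3 and Lemma 2.23]
[cite: HerrmannIkedaOrbanz1988, Cor. (21.12)] -/
theorem isRegularLocalRing_of_isNormallyFlat_of_isRegularLocalRing_localization
    [IsRegularLocalRing (A ⧸ 𝔭)] (hNF : 𝔭.IsNormallyFlat) [IsRegularLocalRing Ap] :
    IsRegularLocalRing A := by
  haveI : IsLocalRing Ap := IsLocalization.AtPrime.isLocalRing Ap 𝔭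
  -- dimensions of `A/𝔭` and `A_𝔭` as natural numbers
  obtain ⟨c, hc⟩ := exists_nat_cast_eq_ringKrullDim (R := A ⧸ 𝔭)
  obtain ⟨e, he⟩ := exists_nat_cast_eq_ringKrullDim (R := Ap)
  -- Bennett's criterion in degree one: `emb dim A = c + emb dim A_𝔭 = c + e`
  have hHS : hilbertFun A = hilbertSamuelFun Ap c :=
    hilbertFun_eq_hilbertSamuelFun_of_isNormallyFlat 𝔭 Ap hc hNF
  have hsp : ((maximalIdeal Ap).spanFinrank : WithBot ℕ∞) = e := by
    rw [IsRegularLocalRing.spanFinrank_maximalIdeal, he]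
  have hsp' : (maximalIdeal Ap).spanFinrank = e := by exact_mod_cast hsp
  have hemb : (maximalIdeal A).spanFinrank = c + e := by
    rw [← hilbertFun_one_eq_spanFinrank, hHS, hilbertSamuelFun_apply_one, hsp']
  -- `dim A/𝔭 + ht 𝔭 ≤ dim A`
  have hp : (𝔭.height : WithBot ℕ∞) = e := by
    rw [← IsLocalization.AtPrime.ringKrullDim_eq_height 𝔭 Ap, he]
  haveI : Nontrivial (A ⧸ 𝔭) := Ideal.Quotient.nontrivial_iff.mpr (Ideal.IsPrime.ne_top ‹_›)
  have hq : (((maximalIdeal A).map (Ideal.Quotient.mk 𝔭)).height : WithBot ℕ∞) = c := by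
    rw [← maximalIdeal_quotient_eq_map, IsLocalRing.maximalIdeal_height_eq_ringKrullDim, hc]
  have hle : (𝔭.height : WithBot ℕ∞) + ((maximalIdeal A).map (Ideal.Quotient.mk 𝔭)).height ≤
      ringKrullDim A := by
    rw [← IsLocalRing.maximalIdeal_height_eq_ringKrullDim, ← WithBot.coe_add, WithBot.coe_le_coe]
    exact height_add_height_map_quotientMk_le (le_maximalIdeal (Ideal.IsPrime.ne_top ‹_›))
  rw [hp, hq] at hle
  -- conclude: `emb dim A ≤ dim A`
  refine IsRegularLocalRing.of_spanFinrank_maximalIdeal_le A ?_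
  rw [hemb, Nat.cast_add, add_comm]
  exact_mod_cast hle

/-- **A permissible centre (CJS Def. 3.1 (2)) with regular generic point lies in the regular locus**:
if `𝔭` is permissible in the Noetherian local ring `A` (`A/𝔭` regular, `A` normally flat along `𝔭`, `𝔭`
in no minimal prime) and `A_𝔭` is regular, then `A` is regular.
[cite: CossartJannsenSaito2020, Def. 3.1 and Thm. 3.3] -/
theorem _root_.Ideal.IsPermissible.isRegularLocalRing_of_isRegularLocalRing_localization
    (h𝔭 : 𝔭.IsPermissible) [IsRegularLocalRing Ap] : IsRegularLocalRing A := by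
  haveI := h𝔭.isRegularLocalRing
  exact isRegularLocalRing_of_isNormallyFlat_of_isRegularLocalRing_localization 𝔭 Ap h𝔭.isNormallyFlat

end Literature.AlgebraicGeometry.Resolution

end
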